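import Summits.Ventures.Crystal3D.Bulk.TopCutInstance2593
import Summits.Ventures.Crystal3D.TopCut.T13c2593Proof
import HarnessLib

/-!
# The UNCONDITIONAL kernel cut from `T13(58.7616°)`: `NoHole 0.556` (ρ* < 56.2204°)

HONEST FRAMING. Part of the venture `Summits/Ventures/Crystal3D` (cell `pub-crystal3d`, phase 2,
24-hour decision sprint; seat typer-bulk). Composition of two tree theorems, nothing else:
seat p2 (g7)'s kernel-checked Bachoc–Vallentin certificate `T13(arccos(2593/5000))`
(`TopCut/T13c2593Proof.lean`: `TopCut.T13c2593.sphereCodeBoundInner_2593_5000 :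
SphereCodeBoundInner (2593/5000)`, standard axioms, kernel `decide`) and this seat's exchange-rate
instance `noHole_0556_of_sphereCodeBoundInner` (`Bulk/TopCutInstance2593.lean`: the PROVED polar
contraction at `λ = 4897/5000`, `ρ₀ = 2453/2500` rad). Results, all with NO hypothesis and standard
axioms:

* **`noHole_0556 : NoHole 0.556`** — twelve `60°`-separated directions on `S²` never leave a hole of
  angular radius `≥ arccos 0.556 = 56.2204…°` (the extremal hole radius of the sprint's (AG) problem is
  `< 56.2204°`; this supersedes `noHole_05419` of `Bulk/TopCutKernel257.lean`, `57.187°`);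
* `gapTupleDiam_1112 : GapTupleDiam 1.112` — near a ball touched by twelve unit-diameter balls every
  further centre is at distance `≥ 1.112` from the central centre;
* `noHole_063_of_window_1112 : ExtremalFreeWindow 1.112 1.26 → NoHole 0.63` — GAP(1.26) follows from
  a census of the hole radii `[50.949877°, 56.2204°]` ALONE (cosine cells down to `t = 0.556`), the top
  being a theorem: in the language of `TARGET-GAP.md` §4.2′ the tiers S-c, S-d and the part of S-b above
  `56.2204°` are discharged IN THE KERNEL (below it the cell's cap cuts, certificate-grade, take over);
  census form `noHole_063_of_census_1112`, bulk form with the classification a hypothesis.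
-/

noncomputable section

namespace Summit.Ventures.Crystal3D

open Literature.Geometry.DiscreteGeometry

/-- **UNCONDITIONAL KERNEL CUT**: `NoHole 0.556` — no shell of twelve `60°`-separated directions on
`S²` has a hole of angular radius `≥ arccos 0.556 = 56.2204…°`. Standard axioms; no hypothesis; no
`native_decide` (p2 g7's kernel `T13(58.7616°)` composed with the proved exchange rate). -/
theorem noHole_0556 : NoHole 0.556 :=
  noHole_0556_of_sphereCodeBoundInner TopCut.T13c2593.sphereCodeBoundInner_2593_5000

/-- Fourteen-ball form, UNCONDITIONAL: `GapTupleDiam 1.112`. -/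
theorem gapTupleDiam_1112 : GapTupleDiam 1.112 :=
  gapTupleDiam_of_noHole (by rw [show (1.112 : ℝ) / 2 = 0.556 by norm_num]; exact noHole_0556)

/-- **GAP(1.26) ⇐ the census of `[50.949877°, 56.2204°]` ALONE**:
`ExtremalFreeWindow 1.112 1.26 → NoHole 0.63`. -/
theorem noHole_063_of_window_1112 (hwin : ExtremalFreeWindow 1.112 1.26) : NoHole 0.63 :=
  noHole_063_of_topCut2593_of_window TopCut.T13c2593.sphereCodeBoundInner_2593_5000 hwin

/-- The same with the census in schema form (`GapCensus.CompleteReducedOn`, `GapCensus.AllKilled`). -/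
theorem noHole_063_of_census_1112 (S : GapCensus) (hC : S.CompleteReducedOn 1.112 1.26)
    (hK : S.AllKilled) : NoHole 0.63 :=
  noHole_063_of_window_1112 (S.extremalFreeWindow hC hK)

/-- **… ⇒ bulk crystallization `K = 702`**, the classification a hypothesis (standard axioms; the
computational discharge is `bulkCrystallization3D_of_noHole_of_window' noHole_0556` of
`Bulk/GapWindowComputational.lean`). -/
theorem bulkCrystallization3D_sharp_of_window_1112_of_classification
    (hwin : ExtremalFreeWindow 1.112 1.26) (hcl : Hales2012_kissingConfigCongruent) :
    BulkCrystallization3D 702 :=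
  bulkCrystallization3D_sharp_of_topCut2593_of_window_of_classification
    TopCut.T13c2593.sphereCodeBoundInner_2593_5000 hwin hcl

end Summit.Ventures.Crystal3D

end
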